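import Mathlib
import Summits.PneNP.PneNP.Theorems.CnfIdealGenLengthRankDefectRepresentationsSimBoundQuasiPoly
import Summits.PneNP.PneNP.Theorems.CnfIdealGenLengthRankDefectRepresentationsSimBoundMono
import Summits.PneNP.PneNP.Theorems.CnfIdealGenLengthRankDefectRepresentationsTwoFamilyCutDomination
import Summits.PneNP.PneNP.Theorems.CnfIdealGenLengthRankDefectRepresentationsMergeFour

/-!
# Crux `RankDefectRepresentations` (stmt-PneNP-18923), line `rank-dehn-ladder`: SIM (= MP_n, the depth-2 core of N0b) is QUASI-POLYNOMIALLY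
# rank-stable — unconditionally (lead g16; memo `Cruxes/RankDefectRepresentations/Lines/rank-dehn-ladder-g16.md` §7)

Lead g8 (`…SimReduction`, memo g8 §6–§8) isolated the gluing problem SIM / MP_n — data `y_k` supported on the `k`-cuts of a cube colouring, pairwise
consistent up to rank `t`, to be glued by ONE matrix `z` with `rank (cut_k (z − y_k)) ≤ C·t` — as the depth-2 core of the item-deciding rung N0b
(`stub_uniformStability`), asked "is `C_n` polynomial?", and reduced a quasi-polynomial bound to a TWO-FAMILY CUT LEMMA; lead g9 reduced that to the
two-dimensional max-cut decomposition (`…TwoFamilyCutDomination`, `…SimBoundQuasiPoly`, `…SimBoundMono`).  Lead g16's constant-4 decomposition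
(`…MergeFour.doubleMaxCut_four_holds`: `DoubleMaxCutDecomposition K n n' 4` for all `K, n, n'`) now makes the whole chain unconditional:

* `twoFamilyCutLemma_four` — the two-family cut lemma for `Fin a ⊕ Fin b` with constant `4ab` (`≤ 4(a+b+1)²`);
* `simBound_quasiPoly` — **`SimBound K (Fin n) (2^{c (log₂ n + 2)²})` for an absolute `c`, i.e. `C_n = n^{O(log n)}`.**

What this is NOT: polynomial (the factor `ab` per halving level comes from cut domination and is tight in the coordinate-cut currency of `SimBound`;
memo §8 (2a)); nor N0b (depth > 2); nor anything about the item RDR.  P ≠ NP is not moved; F-N2 is a FRONTIER formal rung.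
-/

set_option linter.dupNamespace false -- `Summit.PneNP.PneNP.…`: summit = sub-problem name (D-0017)

namespace Summit.PneNP.PneNP.Theorems.CnfIdealGenLengthRankDefectRepresentationsSimQuasiPoly

open Summit.PneNP.PneNP.Theorems.CnfIdealGenLengthRankDefectRepresentationsSimReduction (SimBound TwoFamilyCutLemma)
open Summit.PneNP.PneNP.Theorems.CnfIdealGenLengthRankDefectRepresentationsTwoFamilyCutDomination
  (DoubleMaxCutDecomposition twoFamilyCutLemma_of_decomposition)

/-- Monotonicity of the two-family cut lemma in its constant. -/
theorem twoFamilyCutLemma_mono {K : Type} [Field K] {κ κ' : Type} {lam lam' : ℕ}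
    (h : TwoFamilyCutLemma K κ κ' lam) (hle : lam ≤ lam') : TwoFamilyCutLemma K κ κ' lam' := by
  intro ι ι' _ _ _ _ row col D s hs
  obtain ⟨SI, SJ, h1, h2, h3⟩ := h ι ι' row col D s hs
  exact ⟨SI, SJ, h1, h2, h3.trans (Nat.mul_le_mul_right s hle)⟩

/-- **The two-family cut lemma with a polynomial constant**, unconditionally: `TwoFamilyCutLemma K (Fin a) (Fin b) (4 (a+b+1)²)`
(constant-4 decomposition + double cut domination). -/
theorem twoFamilyCutLemma_four :
    ∃ L e : ℕ, ∀ (K : Type) [Field K] (a b : ℕ), TwoFamilyCutLemma K (Fin a) (Fin b) (L * (a + b + 1) ^ e) := by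
  refine ⟨4, 2, fun K _ a b => ?_⟩
  refine twoFamilyCutLemma_mono (twoFamilyCutLemma_of_decomposition
    (Summit.PneNP.PneNP.Theorems.CnfIdealGenLengthRankDefectRepresentationsMergeFour.doubleMaxCut_four_holds K a b)) ?_
  have ha : a ≤ a + b + 1 := by omega
  have hb : b ≤ a + b + 1 := by omega
  calc 4 * a * b ≤ 4 * (a + b + 1) * (a + b + 1) := by gcongr
    _ = 4 * (a + b + 1) ^ 2 := by ring

/-- **SIM IS QUASI-POLYNOMIALLY RANK-STABLE** (unconditional): there is an absolute `c` with `SimBound K (Fin n) (2^{c (log₂ n + 2)²})` for every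
field `K` and every `n` — i.e. lead g8's `C_n` is at most `n^{O(log n)}`. -/
theorem simBound_quasiPoly :
    ∃ c : ℕ, ∀ (K : Type) [Field K] (n : ℕ), SimBound K (Fin n) (2 ^ (c * (Nat.log 2 n + 2) ^ 2)) := by
  obtain ⟨c, hc⟩ :=
    Summit.PneNP.PneNP.Theorems.CnfIdealGenLengthRankDefectRepresentationsSimBoundQuasiPoly.stub_simBoundQuasiPoly twoFamilyCutLemma_four
  refine ⟨c, fun K _ n => ?_⟩
  have hk : n ≤ 2 ^ (Nat.log 2 n + 1) := (Nat.lt_pow_succ_log_self (by norm_num) n).le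
  have emb : Nonempty (Fin n ↪ Fin (2 ^ (Nat.log 2 n + 1))) := ⟨Fin.castLEEmb hk⟩
  exact Summit.PneNP.PneNP.Theorems.CnfIdealGenLengthRankDefectRepresentationsSimBoundMono.stub_simBoundMono K (Fin n)
    (Fin (2 ^ (Nat.log 2 n + 1))) (2 ^ (c * (Nat.log 2 n + 1 + 1) ^ 2)) (2 ^ (c * (Nat.log 2 n + 2) ^ 2)) emb (le_of_eq (by ring_nf))
    (hc K (Nat.log 2 n + 1))

end Summit.PneNP.PneNP.Theorems.CnfIdealGenLengthRankDefectRepresentationsSimQuasiPoly
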